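import Summits.ABC.ABC.Theorems.SolvedZooCohnOddExponentPell
import Literature.NumberTheory.GaloisRepresentations.HessianType

/-!
# The solved zoo, family (iii) with even `x` is EMPTY — Cohn's negative-Pell count beyond `2z = c² + 1`

Family (iii) of `Summit.ABC.ABC.Theses.ThreeSlotCyclotomicDescent.SolvedZooABC` (stmt-ABC-24025) is
`1 + 2^x·q² = r^z` (`q, r` prime, `r, z` odd, `z ≥ 3`); by `SolvedZooL3Reduction.l3_reduce` (★ p608595)
`r = 2^x + 1`. This file shows, UNCONDITIONALLY, that the case `x = 2s ≥ 2` has no solution at all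
(`l3_even_exponent_empty`, primality of `r` not even needed), so that together with `x` odd ⇒ `3 ∣ 2^x + 1`
the base is `r = 3`, `x = 1` (`l3_base_eq_three`): the only deep input left for family (iii) is the single
equation `2q² + 1 = 3^z` (Ljunggren 1943 / Nagell at base 3), as observed by the abc-inputs audit
(pub/abc-inputs/INPUTS-LIST.md §7 pt 2, 2026-08-28).

The mechanism is exactly J. H. E. Cohn, *Perfect Pell powers*, Glasgow Math. J. 38 (1996) 19–20, p. 20
(the second half of the proof of the LEMMA), run with a general odd divisor `w ∣ c² + 1` in place of
`z = (c²+1)/2`: if `Y² + 1 = (c²+1)·(w^K)²` then `w^K = Im (c + √(c²+1))^{2m+1} = V_m`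
(`cohn_negPell_structure`, ★ p608849), every prime `p ∣ w` divides `c² + 1`, is `≠ 2` (`w` odd) and `≠ 3`
(`3 ∤ c² + 1`), hence `≥ 5` and prime to `c`, so Cohn's `p`-adic comparison
(`cohnPell_prime_pow_succ_dvd_term`) gives `w^K ∣ 2m+1 < V_m = w^K` unless `m = 0`, i.e. `w^K = 1`
(`negPell_pow_dvd_index`, `negPell_pow_eq_one`). For family (iii) with `x = 2s`: `c := 2^s`,
`r = c² + 1`, `(cq)² + 1 = r^z = (c²+1)(r^K)²` (`z = 2K+1`) ⇒ `r^K = 1` ⇒ `r = 1`, absurd.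
(`cohn1996_lemma_odd` itself is the instance `w = z`, `c² + 1 = 2z`; it is assembled by the lead seat
abc-inputs-pr-2 and is not restated here.)

PROOF-ONLY file (no definitions, no named facts, no `sorry`; `3 ∤ c² + 1` is reused from
`Literature/NumberTheory/GaloisRepresentations/HessianType.lean` per the gate's dedup rule); cell abc-inputs (seat pr-3), serves
stmt-ABC-24025 `--supports … --as helper` without closing it. HONESTY: elementary; abc is not touched
(abc moved by 0; NOT abc); family (iii) still needs the base-3 fact `2q² + 1 = 3^z ⇒ z ∈ {1, 2, 5}` in print
(Ljunggren 1943 / Nagell), which is NOT proved here.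
-/

-- `Summit.<Summit>.<Problem>` is the mandated summit-side namespace (CONVENTIONS §2); for the
-- single-conjunct summit `ABC` the two coincide, so the duplicate `ABC.ABC` is deliberate.
set_option linter.dupNamespace false

namespace Summit.ABC.ABC.Theorems

/-- A prime dividing an odd divisor `w` of `c² + 1` is `≥ 5` and does not divide `c`
(it is `≠ 2` as `w` is odd and `≠ 3` as `3 ∤ c² + 1`, the tree's
`Literature.NumberTheory.GaloisRepresentations.Hessian36.not_three_dvd_sq_add_one`). [folklore] -/
theorem five_le_of_prime_dvd_odd_dvd_sq_add_one {c w p : ℕ} (hw : w ∣ c ^ 2 + 1) (hodd : Odd w)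
    (hp : p.Prime) (hpw : p ∣ w) : 5 ≤ p ∧ ¬ p ∣ c := by
  have hpD : p ∣ c ^ 2 + 1 := hpw.trans hw
  refine ⟨hp.five_le_of_ne_two_of_ne_three ?_ ?_, fun hc => ?_⟩
  · rintro rfl
    obtain ⟨r, hr⟩ := hodd
    omega
  · rintro rfl
    exact Literature.NumberTheory.GaloisRepresentations.Hessian36.not_three_dvd_sq_add_one c hpD
  · have h2 : p ∣ 1 := (Nat.dvd_add_right (dvd_pow hc two_ne_zero)).mp hpD
    exact hp.one_lt.ne' (Nat.dvd_one.mp h2)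

/-- **Cohn's `p`-adic comparison for a general odd divisor of `c² + 1`** (Cohn 1996, p. 20 l. 7–12, with
`w ∣ c² + 1` odd in place of `z = (c²+1)/2`): if `w^K = ∑_{j ≤ m} C(2m+1,2j+1) c^{2(m−j)} (c²+1)^j` then
`w^K ∣ 2m+1` — for each prime `p ∣ w` (`p ≥ 5`, `p ∣ c²+1`, `p ∤ c`), `p^e ∣ w^K → p^e ∣ 2m+1` by induction
on `e`, the terms `j ≥ 1` being `≡ 0 (mod p^{e+1})` (`cohnPell_prime_pow_succ_dvd_term`) and the `j = 0`
term being `(2m+1)c^{2m}`. [cite: Cohn1996PerfectPellPowers, Lemma, p. 20] -/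
theorem negPell_pow_dvd_index {c w K m : ℕ} (hw : w ∣ c ^ 2 + 1) (hodd : Odd w)
    (hV : w ^ K = ∑ j ∈ Finset.range (m + 1),
      (2 * m + 1).choose (2 * j + 1) * c ^ (2 * (m - j)) * (c ^ 2 + 1) ^ j) :
    w ^ K ∣ 2 * m + 1 := by
  refine (Nat.dvd_iff_prime_pow_dvd_dvd (2 * m + 1) (w ^ K)).2 fun p k hp hpk => ?_
  induction k with
  | zero => simp
  | succ e ih =>
    have hpe : p ^ e ∣ 2 * m + 1 := ih ((pow_dvd_pow p (Nat.le_succ e)).trans hpk)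
    have hpw : p ∣ w := hp.dvd_of_dvd_pow ((dvd_pow_self p (Nat.succ_ne_zero e)).trans hpk)
    obtain ⟨hp5, hpc⟩ := five_le_of_prime_dvd_odd_dvd_sq_add_one hw hodd hp hpw
    have hpD : p ∣ c ^ 2 + 1 := hpw.trans hw
    have hsplit := Finset.add_sum_erase (Finset.range (m + 1))
      (fun j => (2 * m + 1).choose (2 * j + 1) * c ^ (2 * (m - j)) * (c ^ 2 + 1) ^ j)
      (Finset.mem_range.mpr (Nat.succ_pos m))
    have hrest : p ^ (e + 1) ∣ ∑ j ∈ (Finset.range (m + 1)).erase 0,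
        (2 * m + 1).choose (2 * j + 1) * c ^ (2 * (m - j)) * (c ^ 2 + 1) ^ j := by
      apply Finset.dvd_sum
      intro j hj
      have hj1 : 1 ≤ j := Nat.one_le_iff_ne_zero.mpr (Finset.ne_of_mem_erase hj)
      exact cohnPell_prime_pow_succ_dvd_term hp hp5 hpD hpe hj1
    have h0 : p ^ (e + 1) ∣
        (2 * m + 1).choose (2 * 0 + 1) * c ^ (2 * (m - 0)) * (c ^ 2 + 1) ^ 0 := by
      rw [hV, ← hsplit] at hpk
      exact (Nat.dvd_add_left hrest).mp hpk
    simp only [Nat.mul_zero, Nat.zero_add, Nat.choose_one_right, Nat.sub_zero, pow_zero, mul_one] at h0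
    exact (((Nat.Prime.coprime_iff_not_dvd hp).mpr hpc).pow (e + 1) (2 * m)).dvd_of_dvd_mul_right h0

/-- **Cohn's negative-Pell count, general odd divisor** (Cohn 1996, p. 20, second half of the proof of
the LEMMA, verbatim with `w ∣ c² + 1` odd in place of `z = (c²+1)/2`): if `Y² + 1 = (c² + 1)·(w^K)²`
with `c ≥ 1`, `w ∣ c² + 1`, `w` odd, then `w^K = 1`. Proof: `w^K = V_m` (`cohn_negPell_structure`),
`w^K ∣ 2m+1` (`negPell_pow_dvd_index`), `2m+1 < V_m` for `m ≥ 1` (`cohn_index_lt_sum`), so `m = 0`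
and `w^K = V_0 = 1`. `cohn1996_lemma_odd` is the instance `w = z`, `c² + 1 = 2z`.
[cite: Cohn1996PerfectPellPowers, Lemma, p. 20] -/
theorem negPell_pow_eq_one {c w K : ℕ} {Y : ℤ} (hc : 1 ≤ c) (hw : w ∣ c ^ 2 + 1) (hodd : Odd w)
    (h : Y ^ 2 + 1 = ((c : ℤ) ^ 2 + 1) * ((w ^ K : ℕ) : ℤ) ^ 2) : w ^ K = 1 := by
  have hv : 1 ≤ w ^ K := Nat.one_le_pow _ _ hodd.pos
  obtain ⟨m, hm⟩ := cohn_negPell_structure hc hv h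
  have hdvd := negPell_pow_dvd_index hw hodd hm
  rcases Nat.eq_zero_or_pos m with hm0 | hm0
  · subst hm0
    rw [hm]
    simp
  · have hlt := cohn_index_lt_sum hc (show 1 ≤ c ^ 2 + 1 by omega) hm0
    rw [← hm] at hlt
    have := Nat.le_of_dvd (by omega) hdvd
    omega

/-- **Family (iii) of the solved zoo with even `x ≥ 2` is empty, unconditionally:** for `s ≥ 1`, `z` odd,
`z ≥ 3` and every `q`, `(2^{2s} + 1)^z ≠ 2^{2s}·q² + 1`. (With `c := 2^s`, `r := c² + 1` (odd; primality
not needed), `z = 2K+1`: `(cq)² + 1 = r^z = (c²+1)(r^K)²`, so `negPell_pow_eq_one` gives `r^K = 1`,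
i.e. `r = 1`, absurd.) Cohn 1996's argument (p. 20) applied at `w = r`; cf. abc-inputs audit
INPUTS-LIST §7 pt 2. [cite: Cohn1996PerfectPellPowers, Lemma, p. 20] -/
theorem l3_even_exponent_empty {s q z : ℕ} (hs : 1 ≤ s) (hz : Odd z) (h3 : 3 ≤ z) :
    (2 ^ (2 * s) + 1) ^ z ≠ 2 ^ (2 * s) * q ^ 2 + 1 := by
  intro h
  obtain ⟨K, rfl⟩ := hz
  have hK : K ≠ 0 := by omega
  have hcs : 2 ^ (2 * s) = (2 ^ s) ^ 2 := by rw [← pow_mul, mul_comm]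
  rw [hcs] at h
  set c : ℕ := 2 ^ s with hc
  have hc1 : 1 ≤ c := Nat.one_le_two_pow
  have hY : ((c * q : ℕ) : ℤ) ^ 2 + 1 = ((c : ℤ) ^ 2 + 1) * (((c ^ 2 + 1) ^ K : ℕ) : ℤ) ^ 2 := by
    have h' : (c * q) ^ 2 + 1 = (c ^ 2 + 1) * ((c ^ 2 + 1) ^ K) ^ 2 := by
      calc (c * q) ^ 2 + 1 = c ^ 2 * q ^ 2 + 1 := by ring
        _ = (c ^ 2 + 1) ^ (2 * K + 1) := h.symm
        _ = (c ^ 2 + 1) * ((c ^ 2 + 1) ^ K) ^ 2 := by ring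
    exact_mod_cast h'
  have hodd : Odd (c ^ 2 + 1) := by
    have h2c : 2 ∣ c := by rw [hc]; exact dvd_pow_self 2 (by omega)
    obtain ⟨t, ht⟩ := h2c
    exact ⟨2 * t * t, by rw [ht]; ring⟩
  have h1 := negPell_pow_eq_one hc1 (dvd_refl (c ^ 2 + 1)) hodd hY
  rcases Nat.pow_eq_one.mp h1 with h2 | h2
  · have : 1 ≤ c ^ 2 := Nat.one_le_pow _ _ hc1
    omega
  · exact hK h2

/-- If `x` is odd then `3 ∣ 2^x + 1`. [folklore] -/
theorem three_dvd_two_pow_add_one_of_odd {x : ℕ} (hx : Odd x) : 3 ∣ 2 ^ x + 1 := by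
  obtain ⟨s, rfl⟩ := hx
  have h4 : 4 ^ s % 3 = 1 := by
    have := Nat.ModEq.pow s (show 4 ≡ 1 [MOD 3] by decide)
    rw [one_pow] at this
    exact this
  have h2 : 2 ^ (2 * s + 1) = 2 * 4 ^ s := by
    rw [pow_succ, pow_mul, show (2 : ℕ) ^ 2 = 4 by norm_num]; ring
  rw [h2]
  omega

/-- **Family (iii) of the solved zoo lives at base `3`:** if `r` is an odd prime with `r = 2^x + 1` and
`r^z = 2^x·q² + 1` for some odd `z ≥ 3`, then `r = 3` and `x = 1` (so the equation is `2q² + 1 = 3^z`).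
Even `x ≥ 2` is excluded by `l3_even_exponent_empty`, `x = 0` by `r` odd, and for odd `x`, `3 ∣ 2^x + 1 = r`.
Combine with `SolvedZooL3Reduction.l3_reduce` (★ p608595, which supplies `r = 2^x + 1`).
[cite: Cohn1996PerfectPellPowers, Lemma, p. 20] -/
theorem l3_base_eq_three {x q z r : ℕ} (hr : r.Prime) (hro : Odd r) (hx : r = 2 ^ x + 1)
    (hz : Odd z) (h3 : 3 ≤ z) (h : r ^ z = 2 ^ x * q ^ 2 + 1) : r = 3 ∧ x = 1 := by
  rcases Nat.even_or_odd x with ⟨s, hs⟩ | hxo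
  · -- `x = 2s`: `s = 0` contradicts `r` odd, `s ≥ 1` is the empty even case
    exfalso
    rcases Nat.eq_zero_or_pos s with h0 | h0
    · subst h0
      simp at hs
      subst hs
      norm_num at hx
      subst hx
      exact (Nat.not_even_iff_odd.mpr hro) even_two
    · have hx2 : x = 2 * s := by omega
      subst hx2
      subst hx
      exact l3_even_exponent_empty h0 hz h3 h
  · have h3r : 3 ∣ r := hx ▸ three_dvd_two_pow_add_one_of_odd hxo
    have hr3 : r = 3 := ((Nat.prime_dvd_prime_iff_eq Nat.prime_three hr).mp h3r).symm
    refine ⟨hr3, ?_⟩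
    subst hr3
    -- `2^x = 2` ⇒ `x = 1`
    have h2 : 2 ^ x = 2 ^ 1 := by omega
    exact Nat.pow_right_injective le_rfl h2

end Summit.ABC.ABC.Theorems
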